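import Literature.AnabelianGeometry.SemiGraphs.TemperedAnabelianThm68Sub

/-!
# Plumbing for [SemiAnbd] Thm. 6.8 (ii)/(iii)/(iv) ([Mzk8] Cor. 2.5 mechanism): representatives of isomorphisms of `DLoc_{G_K}(Π^temp_{X_K})`, transport of subgroups along isomorphisms of topological groups, the object `X_K`

Mochizuki, *Semi-graphs of anabelioids* [SemiAnbd], §6 Thm. 6.8, kurims pp. 74–75, whose printed proof
is [Mzk8] (*Galois sections in absolute anabelian geometry*) §2; the steps typed and PROVED here are
the "immediately from the definitions" parts of [Mzk8] Cor. 2.5 (ms. p. 9) in the tempered setting: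
an isomorphism in abc-iut-L3-t4's genuine-morphism category `DLocObj.dlocCategory X` is represented by
a continuous ISOMORPHISM `J ⥲ J'` (`Thm68Sub.exists_equiv_of_iso`); relative openness, compactness,
commensurable terminality and conjugation are transported along isomorphisms of topological groups;
an open subgroup of a compact subgroup has finite index; for the object `X_K` itself (no cusp filled
in) the kernel `N` is the closure of the trivial subgroup, hence is respected by transport; two
group-theoretic objects with the same `(H, N)` have isomorphic `J` through the identity
(`Thm68Sub.jEquivOfEq`, public version of the bookkeeping of `TemperedAnabelianThm68SubProofs.lean`).
[cite: MochizukiSemiAnbd2006, Thm 6.8 pp.74-75] [cite: MochizukiGalSect2005, Cor 2.5 p.9]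

Companion (abc-iut cell, layer L3, seat abc-iut-w5-d040) to `TemperedAnabelianThm68Sub.lean`
(plan/L3/SUBDAG-SemiAnbd-Thm68.md, row T68-B5); consumed by `TemperedDLocTypePreservedProofs.lean`.
Pure group theory / topology / category bookkeeping; nothing of [SemiAnbd]/[Mzk8] is asserted; nothing
here takes a side on [IUTchIII] Cor. 3.12.
-/

noncomputable section

namespace Literature.AnabelianGeometry.SemiGraphs

open scoped Pointwise
open CategoryTheory Topology

variable {p : ℕ} [Fact p.Prime]

namespace Thm68Sub

/-! ### Plumbing in `DLocObj.dlocCategory`: representatives of isomorphisms -/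

section IsoReps

variable {X : TemperedCurve p}

/-- In `DLoc_{G_K}(Π^temp_{X_K})`, `homMk φ ≫ homMk ψ = homMk (ψ ∘ φ)` (definition of composition).
[cite: MochizukiSemiAnbd2006, §6 p.74] -/
theorem homMk_comp_homMk {A B C : DLocObj X} (φ : DLocObj.HomRep A B) (ψ : DLocObj.HomRep B C) :
    letI := DLocObj.dlocCategory X
    DLocObj.homMk φ ≫ DLocObj.homMk ψ = DLocObj.homMk (ψ.comp φ) := rfl

/-- Equal classes of representatives differ by an inner automorphism of the target.
[cite: MochizukiSemiAnbd2006, §6 p.74] -/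
theorem exists_conj_of_homMk_eq {A B : DLocObj X} {φ ψ : DLocObj.HomRep A B}
    (h : (DLocObj.homMk φ : letI := DLocObj.dlocCategory X; A ⟶ B) = DLocObj.homMk ψ) :
    ∃ b : B.J, ∀ j, ψ.toHom j = b * φ.toHom j * b⁻¹ :=
  Quotient.exact h

/-- An isomorphism `e : P ≅ Q` of `DLoc_{G_K}(Π^temp_{X_K})` is represented by a continuous
ISOMORPHISM of tempered groups `P.J ⥲ Q.J` (a representative of `e.hom` is bijective; its inverse is
a conjugate of a representative of `e.inv`, hence continuous). [cite: MochizukiSemiAnbd2006, §6 p.74] -/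
theorem exists_equiv_of_iso {P Q : DLocObj X} (e : letI := DLocObj.dlocCategory X; P ≅ Q) :
    ∃ (φ : DLocObj.HomRep P Q) (θ : P.J ≃ₜ* Q.J),
      (letI := DLocObj.dlocCategory X; e.hom = DLocObj.homMk φ) ∧ ∀ j, θ j = φ.toHom j := by
  letI := DLocObj.dlocCategory X
  obtain ⟨φ, hφ⟩ := Quotient.exists_rep e.hom
  obtain ⟨ψ, hψ⟩ := Quotient.exists_rep e.inv
  have h1 : DLocObj.homMk (ψ.comp φ) = DLocObj.homMk (DLocObj.HomRep.id P) := by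
    rw [← homMk_comp_homMk]
    change Quotient.mk _ φ ≫ Quotient.mk _ ψ = 𝟙 P
    rw [hφ, hψ, e.hom_inv_id]
  have h2 : DLocObj.homMk (φ.comp ψ) = DLocObj.homMk (DLocObj.HomRep.id Q) := by
    rw [← homMk_comp_homMk]
    change Quotient.mk _ ψ ≫ Quotient.mk _ φ = 𝟙 Q
    rw [hφ, hψ, e.inv_hom_id]
  obtain ⟨b, hb⟩ := exists_conj_of_homMk_eq h1
  obtain ⟨c, hc⟩ := exists_conj_of_homMk_eq h2
  -- `hb : ∀ j, j = b * ψ (φ j) * b⁻¹`, `hc : ∀ q, q = c * φ (ψ q) * c⁻¹`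
  have hb' : ∀ j : P.J, ψ.toHom (φ.toHom j) = b⁻¹ * j * b := by
    intro j
    have hj : j = b * ψ.toHom (φ.toHom j) * b⁻¹ := hb j
    calc ψ.toHom (φ.toHom j) = b⁻¹ * (b * ψ.toHom (φ.toHom j) * b⁻¹) * b := by group
      _ = b⁻¹ * j * b := by rw [← hj]
  have hc' : ∀ q : Q.J, φ.toHom (ψ.toHom q) = c⁻¹ * q * c := by
    intro q
    have hq : q = c * φ.toHom (ψ.toHom q) * c⁻¹ := hc q
    calc φ.toHom (ψ.toHom q) = c⁻¹ * (c * φ.toHom (ψ.toHom q) * c⁻¹) * c := by group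
      _ = c⁻¹ * q * c := by rw [← hq]
  -- the inverse map `q ↦ b · ψ(q) · b⁻¹`
  have hleft : Function.LeftInverse (fun q => b * ψ.toHom q * b⁻¹) φ.toHom := by
    intro j
    change b * ψ.toHom (φ.toHom j) * b⁻¹ = j
    rw [hb']; group
  have hsurj : Function.Surjective φ.toHom := by
    intro q
    exact ⟨ψ.toHom (c * q * c⁻¹), by rw [hc']; group⟩
  have hright : Function.RightInverse (fun q => b * ψ.toHom q * b⁻¹) φ.toHom := by
    intro q
    obtain ⟨j, rfl⟩ := hsurj q
    rw [hleft j]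
  let θ : P.J ≃ₜ* Q.J :=
    { toFun := φ.toHom, invFun := fun q => b * ψ.toHom q * b⁻¹, left_inv := hleft,
      right_inv := hright, map_mul' := map_mul _, continuous_toFun := φ.toHom.continuous,
      continuous_invFun := (continuous_const.mul ψ.toHom.continuous).mul continuous_const }
  exact ⟨φ, θ, hφ.symm, fun j => rfl⟩

end IsoReps

/-! ### Plumbing: transporting subgroups along isomorphisms of topological groups -/

section Transport

variable {G G' : Type*} [Group G] [TopologicalSpace G] [IsTopologicalGroup G]
  [Group G'] [TopologicalSpace G'] [IsTopologicalGroup G']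

/-- Conjugation by `g` as an isomorphism of topological groups (step of [Mzk8] Cor. 2.5: decomposition
groups are compared up to conjugation). [cite: MochizukiGalSect2005, Cor 2.5 p.9] -/
def conjCME (g : G) : G ≃ₜ* G where
  toFun h := g * h * g⁻¹
  invFun h := g⁻¹ * h * g
  left_inv h := by group
  right_inv h := by group
  map_mul' a b := by group
  continuous_toFun := (continuous_const.mul continuous_id).mul continuous_const
  continuous_invFun := (continuous_const.mul continuous_id).mul continuous_const

/-- `conjCME g h = g h g⁻¹`. [cite: MochizukiGalSect2005, Cor 2.5 p.9] -/
@[simp] theorem conjCME_apply (g h : G) : conjCME g h = g * h * g⁻¹ := rfl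

/-- `K.map (conj g) = g • K`. [cite: MochizukiGalSect2005, Cor 2.5 p.9] -/
theorem map_conjCME (g : G) (K : Subgroup G) :
    K.map (conjCME g).toMulEquiv.toMonoidHom = ConjAct.toConjAct g • K := by
  ext y
  rw [Subgroup.mem_map, Subgroup.mem_smul_pointwise_iff_exists]
  constructor
  · rintro ⟨k, hk, rfl⟩
    exact ⟨k, hk, by rw [ConjAct.smul_def, ConjAct.ofConjAct_toConjAct]; rfl⟩
  · rintro ⟨k, hk, rfl⟩
    exact ⟨k, hk, by rw [ConjAct.smul_def, ConjAct.ofConjAct_toConjAct]; rfl⟩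

/-- The restriction of an isomorphism of topological groups to a subgroup is a homeomorphism onto its
image. [cite: MochizukiGalSect2005, Cor 2.5 p.9] -/
def subgroupCME (F : G ≃ₜ* G') (D : Subgroup G) : D ≃ₜ* D.map F.toMulEquiv.toMonoidHom where
  toMulEquiv := F.toMulEquiv.subgroupMap D
  continuous_toFun := continuous_induced_rng.2 (by exact F.continuous.comp continuous_subtype_val)
  continuous_invFun :=
    continuous_induced_rng.2 (by exact F.symm.continuous.comp continuous_subtype_val)

omit [IsTopologicalGroup G] [IsTopologicalGroup G'] in
/-- Relative openness is transported along an isomorphism of topological groups (step of [Mzk8]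
Cor. 2.5: "`D_x` admits an open subgroup …" is transported). [cite: MochizukiGalSect2005, Cor 2.5 p.9] -/
theorem isOpen_subgroupOf_map (F : G ≃ₜ* G') {U D : Subgroup G}
    (hU : IsOpen ((U.subgroupOf D : Subgroup D) : Set D)) :
    IsOpen (((U.map F.toMulEquiv.toMonoidHom).subgroupOf (D.map F.toMulEquiv.toMonoidHom) :
      Subgroup (D.map F.toMulEquiv.toMonoidHom)) : Set (D.map F.toMulEquiv.toMonoidHom)) := by
  have hset : (((U.map F.toMulEquiv.toMonoidHom).subgroupOf (D.map F.toMulEquiv.toMonoidHom) :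
      Subgroup (D.map F.toMulEquiv.toMonoidHom)) : Set (D.map F.toMulEquiv.toMonoidHom)) =
      (subgroupCME F D) '' ((U.subgroupOf D : Subgroup D) : Set D) := by
    ext ⟨y, hy⟩
    simp only [SetLike.mem_coe, Subgroup.mem_subgroupOf, Subgroup.mem_map, Set.mem_image]
    constructor
    · rintro ⟨u, hu, huy⟩
      obtain ⟨d, hd, hdy⟩ := hy
      have hud : u = d := F.injective (huy.trans hdy.symm)
      subst hud
      exact ⟨⟨u, hd⟩, hu, Subtype.ext huy⟩
    · rintro ⟨⟨d, hd⟩, hdU, hde⟩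
      exact ⟨d, hdU, congrArg Subtype.val hde⟩
  rw [hset]
  exact (subgroupCME F D).toHomeomorph.isOpenMap _ hU

omit [IsTopologicalGroup G] [IsTopologicalGroup G'] in
/-- Compactness is transported along an isomorphism of topological groups.
[cite: MochizukiGalSect2005, Cor 2.5 p.9] -/
theorem isCompact_map (F : G ≃ₜ* G') {D : Subgroup G} (hD : IsCompact (D : Set G)) :
    IsCompact ((D.map F.toMulEquiv.toMonoidHom : Subgroup G') : Set G') := by
  rw [Subgroup.coe_map]
  exact hD.image F.continuous

omit [TopologicalSpace G] [IsTopologicalGroup G] [TopologicalSpace G'] [IsTopologicalGroup G'] in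
/-- Commensurable terminality ([SemiAnbd] Thm. 6.5 (ii)) is transported along an isomorphism of
groups. [cite: MochizukiGalSect2005, Cor 2.5 p.9] -/
theorem commensurator_map_eq (F : G ≃* G') {D : Subgroup G}
    (hD : Subgroup.Commensurable.commensurator D = D) :
    Subgroup.Commensurable.commensurator (D.map F.toMonoidHom) = D.map F.toMonoidHom := by
  ext y
  obtain ⟨g, rfl⟩ := F.surjective y
  have hconj : ConjAct.toConjAct (F g) • D.map F.toMonoidHom =
      (ConjAct.toConjAct g • D).map F.toMonoidHom := by
    ext z
    simp only [Subgroup.mem_smul_pointwise_iff_exists, Subgroup.mem_map, ConjAct.smul_def,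
      ConjAct.ofConjAct_toConjAct]
    constructor
    · rintro ⟨_, ⟨d, hd, rfl⟩, rfl⟩
      exact ⟨g * d * g⁻¹, ⟨d, hd, rfl⟩, by simp [map_mul, map_inv]⟩
    · rintro ⟨_, ⟨d, hd, rfl⟩, rfl⟩
      exact ⟨F d, ⟨d, hd, rfl⟩, by simp [map_mul, map_inv]⟩
  rw [Subgroup.Commensurable.commensurator_mem_iff, hconj, Subgroup.Commensurable,
    Subgroup.relIndex_map_map_of_injective _ _ F.injective,
    Subgroup.relIndex_map_map_of_injective _ _ F.injective]
  change Subgroup.Commensurable (ConjAct.toConjAct g • D) D ↔ _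
  rw [← Subgroup.Commensurable.commensurator_mem_iff, hD, Subgroup.mem_map]
  constructor
  · intro hg; exact ⟨g, hg, rfl⟩
  · rintro ⟨g', hg', hgg'⟩; rwa [← F.injective hgg']

/-- An open subgroup of a compact subgroup has finite index in it (the tacit step of [Mzk8] Cor. 2.5
behind "an open subgroup of `D_x`"). [cite: MochizukiGalSect2005, Cor 2.5 p.9] -/
theorem finiteIndex_subgroupOf_of_isOpen {U D : Subgroup G} (hD : IsCompact (D : Set G))
    (hU : IsOpen ((U.subgroupOf D : Subgroup D) : Set D)) : (U.subgroupOf D).FiniteIndex := by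
  haveI : CompactSpace D := isCompact_iff_compactSpace.1 hD
  haveI := Subgroup.quotient_finite_of_isOpen _ hU
  exact Subgroup.finiteIndex_of_finite_quotient

omit [TopologicalSpace G] [IsTopologicalGroup G] [TopologicalSpace G'] [IsTopologicalGroup G'] in
/-- `(g • K).map F = F(g) • K.map F` for a group homomorphism `F`.
[cite: MochizukiGalSect2005, Cor 2.5 p.9] -/
theorem map_smul_eq (F : G →* G') (g : G) (K : Subgroup G) :
    (ConjAct.toConjAct g • K).map F = ConjAct.toConjAct (F g) • K.map F := by
  ext z
  simp only [Subgroup.mem_smul_pointwise_iff_exists, Subgroup.mem_map, ConjAct.smul_def,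
    ConjAct.ofConjAct_toConjAct]
  constructor
  · rintro ⟨_, ⟨d, hd, rfl⟩, rfl⟩
    exact ⟨F d, ⟨d, hd, rfl⟩, by simp [map_mul, map_inv]⟩
  · rintro ⟨_, ⟨d, hd, rfl⟩, rfl⟩
    exact ⟨g * d * g⁻¹, ⟨d, hd, rfl⟩, by simp [map_mul, map_inv]⟩

end Transport

/-! ### The object `X_K` of `DLoc`: `H = Π^temp_{X_K}`, no cusp filled in -/

section SelfObject

variable {X Y : TemperedCurve p}

/-- For an object with no generator, `N` is the closure of the trivial subgroup (the defining formula
`N = \overline{⟨⟨∅⟩⟩}` inside the OPEN — hence closed — subgroup `H`). [cite: MochizukiSemiAnbd2006, §6 p.74] -/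
theorem N_eq_of_gens_empty (A : DLocObj X) (h : A.gens = ∅) :
    A.N = (⊥ : Subgroup X.PiTemp).topologicalClosure := by
  apply SetLike.coe_injective
  rw [A.N_eq, h]
  simp only [Set.mem_empty_iff_false, Set.iUnion_of_empty, Set.iUnion_empty,
    Subgroup.normalClosure_empty]
  rw [Subgroup.coe_map, Subgroup.topologicalClosure_coe, Subgroup.topologicalClosure_coe,
    Subgroup.coe_bot, Subgroup.coe_bot]
  -- closure in the subspace `H` of `{1}`, pushed to `G`, is the closure of `{1}` in `G`
  have hemb : Topology.IsEmbedding (A.H.subtype : A.H → X.PiTemp) := Topology.IsEmbedding.subtypeVal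
  rw [hemb.closure_eq_preimage_closure_image, Set.image_preimage_eq_inter_range]
  have h1 : (A.H.subtype : A.H → X.PiTemp) '' ({1} : Set A.H) = {1} := by
    rw [Set.image_singleton]; rfl
  rw [h1]
  -- `closure {1} ⊆ H` since `H` is an open, hence closed, subgroup containing `1`
  have hcl : closure ({1} : Set X.PiTemp) ⊆ Set.range (A.H.subtype : A.H → X.PiTemp) := by
    rw [Subgroup.coe_subtype, Subtype.range_coe]
    exact (Subgroup.isClosed_of_isOpen A.H A.isOpen_H).closure_subset_iff.2
      (Set.singleton_subset_iff.2 A.H.one_mem)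
  rw [Set.inter_eq_left.2 hcl]

/-- Hence, for such an object, `N` is carried to the corresponding `N` by any isomorphism of
topological groups: `α(\overline{{1}}) = \overline{{1}}`. [cite: MochizukiSemiAnbd2006, §6 p.74] -/
theorem map_N_eq_of_gens_empty (α : X.PiTemp ≃ₜ* Y.PiTemp) (A : DLocObj X) (h : A.gens = ∅)
    (B : DLocObj Y) (hB : B.gens = ∅) :
    A.N.map α.toMulEquiv.toMonoidHom = B.N := by
  rw [N_eq_of_gens_empty A h, N_eq_of_gens_empty B hB, DLocObj.map_topologicalClosure_equiv,
    Subgroup.map_bot]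

/-- Two group-theoretic objects with the same `(H, N)` have isomorphic `J = H/N` via the identity,
over `G_K` (public version of the private bookkeeping of `TemperedAnabelianThm68SubProofs.lean`).
[cite: MochizukiSemiAnbd2006, §6 p.74] -/
def jEquivOfEq (A B : DLocObj Y) (hH : A.H = B.H) (hN : A.N = B.N) : A.J ≃ₜ* B.J :=
  haveI := A.normal_subgroupOf_N
  haveI := B.normal_subgroupOf_N
  have hmap : A.NH.map (MulEquiv.subgroupCongr hH).toMonoidHom = B.NH := by
    rw [A.NH_eq, B.NH_eq]
    ext ⟨y, hy⟩
    constructor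
    · rintro ⟨⟨x, hx⟩, hxN, hxy⟩
      have : x = y := by simpa using congrArg Subtype.val hxy
      subst this
      exact Subgroup.mem_subgroupOf.2 (hN ▸ (Subgroup.mem_subgroupOf.1 hxN))
    · intro hyN
      refine ⟨⟨y, hH ▸ hy⟩, Subgroup.mem_subgroupOf.2 (hN.symm ▸ Subgroup.mem_subgroupOf.1 hyN), ?_⟩
      ext; rfl
  { QuotientGroup.congr A.NH B.NH (MulEquiv.subgroupCongr hH) hmap with
    continuous_toFun := by
      apply (QuotientGroup.isQuotientMap_mk A.NH).continuous_iff.2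
      change Continuous (fun h : A.H => (QuotientGroup.mk (MulEquiv.subgroupCongr hH h) : B.J))
      exact QuotientGroup.continuous_mk.comp (Continuous.subtype_mk continuous_subtype_val _)
    continuous_invFun := by
      apply (QuotientGroup.isQuotientMap_mk B.NH).continuous_iff.2
      change Continuous (fun h : B.H => (QuotientGroup.mk ((MulEquiv.subgroupCongr hH).symm h) : A.J))
      exact QuotientGroup.continuous_mk.comp (Continuous.subtype_mk continuous_subtype_val _) }

/-- `jEquivOfEq` on classes. [cite: MochizukiSemiAnbd2006, §6 p.74] -/
theorem jEquivOfEq_mk (A B : DLocObj Y) (hH : A.H = B.H) (hN : A.N = B.N) (h : A.H) :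
    jEquivOfEq A B hH hN (A.proj h) = B.proj (MulEquiv.subgroupCongr hH h) := rfl

/-- `jEquivOfEq` lies over `G_K`. [cite: MochizukiSemiAnbd2006, §6 p.74] -/
theorem augJ_jEquivOfEq (A B : DLocObj Y) (hH : A.H = B.H) (hN : A.N = B.N) (j : A.J) :
    B.augJ (jEquivOfEq A B hH hN j) = A.augJ j := by
  obtain ⟨h, rfl⟩ := QuotientGroup.mk_surjective j
  change B.augJ (jEquivOfEq A B hH hN (A.proj h)) = A.augJ (A.proj h)
  rw [jEquivOfEq_mk, DLocObj.augJ_proj, DLocObj.augJ_proj]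
  rfl

end SelfObject

end Thm68Sub

end Literature.AnabelianGeometry.SemiGraphs

end
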